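import Summits.Ventures.Crystal3D.Theorems.StickyWulffConstantTextureLiminfTexShadowSplitDefs
import Summits.Ventures.Crystal3D.Theorems.StickyWulffConstantTextureLiminfLineCountGlue
import HarnessLib

/-!
# `BilayerWallCoveredFrom R` from lane G's line counts (the covered wall stub BY NAME, modulo F4)
# (lane T, crux `TextureLiminf`, stmt-Ventures-19483; registered line `TexShadow` v6.7/v6.8, stub `stub_bilayerWallCovered`)

HONEST FRAMING. Venture `Summits/Ventures/Crystal3D` (cell `crystal3d-full`), helper `--supports` the crux
`TextureLiminf` (stmt-Ventures-19483) of `route-Ventures-StickyWulffConstant`, registered line `TexShadow` (cf-p1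
ROUTE.md §86(58) BA, §86(67) BJ).  Rung credit only; F-C1 not moved.  NOT the wall law: the covered part only, and
CONDITIONAL on lane G's F4 line counts (hypothesis `hlines`).

`stub_bilayerWallCovered : ∃ R, 1 ≤ R ∧ BilayerWallCoveredFrom R` (v6.7) asks for the cell inequality `BilayerWallAt`
for every generic pair of Barlow plates and every admissible, FLUX-DOMINATED (`√2/2`) charge table.  The T-side chain
(`…FluxCount(Sel)`, `…CellFlux(Sel)`, `…LineCountGlue`) reduces it to a statement WITHOUT tables: per thickness `R₀ ≥ R`
one rim constant `C_w`, and for every plate pair step selectors of the two plates whose window lines, cell by cell, are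
counted by the payers — `#T₁ + #T₂ + 18·m·ρ ≤ Σ_{PAY} (12 − deg) + C_w (1+h) ρ` (lane G's F4: CAP-START walker families,
`walkerFamilies_card_le_payers`, sealing, orbit-freeness; its E1 input upstream).

* **`bilayerWallCoveredFrom_of_lineCounts`** — `3 ≤ R` and `hlines` ⇒ `BilayerWallCoveredFrom R`
  (rim constant `(C_w + 80(R₀+9) + 3456 + 1152(R₀+1))/2`; the frames, the residual-class exclusion and the axes `m` of
  `BilayerWallCovered` are idle for the covered part: flux domination alone drives it).
WHAT THIS IS NOT: not F4, not E1; F-C1 not moved.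
-/

noncomputable section

namespace Summit.Ventures.Crystal3D.Theorems

open scoped InnerProductSpace
open Literature.MathematicalPhysics.StatisticalMechanics (IsHaggSeq triangularVec₁ triangularVec₂)
open Summit.Ventures.Crystal3D.Cruxes.TextureLiminf.TexShadow (E3 e₃ cyl stacking BilayerWallAt BilayerWallCovered
  BilayerWallCoveredFrom FluxDominated)

/-- **The covered wall law from line counts.**  See the module docstring. -/
theorem bilayerWallCoveredFrom_of_lineCounts (R : ℝ) (hR : 3 ≤ R)
    (hlines : ∀ R₀ : ℝ, R ≤ R₀ → ∃ C_w : ℝ, ∀ (σ₁ σ₂ : ℤ → ℤ), IsHaggSeq σ₁ → IsHaggSeq σ₂ →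
      ∀ (L₁ L₂ : E3 ≃ₗᵢ[ℝ] E3) (s₁ s₂ : E3),
      ∃ step₁ step₂ : ℤ → E3, IsZigSelector L₁ σ₁ e₃ step₁ ∧ IsZigSelector L₂ σ₂ (-e₃) step₂ ∧
      ∀ h : ℝ, 0 ≤ h → ∀ ρ : ℝ, R₀ ≤ ρ → ∀ X P₁ P₂ : Finset E3,
      (∀ p ∈ X, ∀ q ∈ X, p ≠ q → 1 ≤ dist p q) → P₁ ⊆ X → P₂ ⊆ X \ P₁ → (∀ p ∈ X, p ∈ cyl R₀ h ρ) →
      (∀ p, p ∈ P₁ ↔ (p ∈ stacking L₁ s₁ σ₁ ∧ -(2 * R₀) ≤ p 2 ∧ p 2 ≤ -R₀ ∧ p 0 ^ 2 + p 1 ^ 2 ≤ ρ ^ 2)) →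
      (∀ p, p ∈ P₂ ↔ (p ∈ stacking L₂ s₂ σ₂ ∧ h + R₀ ≤ p 2 ∧ p 2 ≤ h + 2 * R₀ ∧ p 0 ^ 2 + p 1 ^ 2 ≤ ρ ^ 2)) →
      ∃ (m : ℝ) (T₁ T₂ : Finset (Fin 2 → ℤ)), 0 ≤ m ∧
        (∀ t : Fin 2 → ℤ, (∃ k : ℤ,
          -R₀ - 4 ≤ (L₁ (zigVertexS step₁ k + ((t 0 : ℝ) • triangularVec₁ 1 + (t 1 : ℝ) • triangularVec₂ 1)) + s₁) 2 ∧
          (L₁ (zigVertexS step₁ k + ((t 0 : ℝ) • triangularVec₁ 1 + (t 1 : ℝ) • triangularVec₂ 1)) + s₁) 2 ≤ -R₀ - 3 ∧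
          Real.sqrt ((L₁ (zigVertexS step₁ k + ((t 0 : ℝ) • triangularVec₁ 1 + (t 1 : ℝ) • triangularVec₂ 1)) + s₁) 0 ^ 2 +
            (L₁ (zigVertexS step₁ k + ((t 0 : ℝ) • triangularVec₁ 1 + (t 1 : ℝ) • triangularVec₂ 1)) + s₁) 1 ^ 2) ≤ ρ - m) →
          t ∈ T₁) ∧
        (∀ t : Fin 2 → ℤ, (∃ k : ℤ,
          h + R₀ + 3 ≤ (L₂ (zigVertexS step₂ k + ((t 0 : ℝ) • triangularVec₁ 1 + (t 1 : ℝ) • triangularVec₂ 1)) + s₂) 2 ∧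
          (L₂ (zigVertexS step₂ k + ((t 0 : ℝ) • triangularVec₁ 1 + (t 1 : ℝ) • triangularVec₂ 1)) + s₂) 2 ≤ h + R₀ + 4 ∧
          Real.sqrt ((L₂ (zigVertexS step₂ k + ((t 0 : ℝ) • triangularVec₁ 1 + (t 1 : ℝ) • triangularVec₂ 1)) + s₂) 0 ^ 2 +
            (L₂ (zigVertexS step₂ k + ((t 0 : ℝ) • triangularVec₁ 1 + (t 1 : ℝ) • triangularVec₂ 1)) + s₂) 1 ^ 2) ≤ ρ - m) →
          t ∈ T₂) ∧
        (T₁.card : ℝ) + T₂.card + 18 * m * ρ ≤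
          (∑ y ∈ X.filter (fun y => (X.filter fun q => dist y q = 1).card ≠ 12 ∧ -R₀ - 2 ≤ y 2 ∧ y 2 ≤ h + R₀ + 2),
            ((12 : ℝ) - ((X.filter fun q => dist y q = 1).card : ℝ))) + C_w * (1 + h) * ρ) :
    BilayerWallCoveredFrom R := by
  intro R₀ hR₀
  obtain ⟨C_w, hC⟩ := hlines R₀ hR₀
  refine ⟨(C_w + 80 * (R₀ + 9) + 3456 + 1152 * (R₀ + 1)) / 2, ?_⟩
  intro σ₁ σ₂ hσ₁ hσ₂ L₁ L₂ s₁ s₂ A₁ A₂ u₁ u₂ _hA₁ _hA₂ _hgen c m hadm hflux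
  obtain ⟨step₁, step₂, hsel₁, hsel₂, hF4⟩ := hC σ₁ σ₂ hσ₁ hσ₂ L₁ L₂ s₁ s₂
  exact bilayerWallAt_of_lineCount hσ₁ hσ₂ L₁ L₂ s₁ s₂ (Real.sqrt 2 / 2) R₀ C_w (le_trans hR hR₀) c hadm.1 hflux
    hsel₁ hsel₂ hF4

end Summit.Ventures.Crystal3D.Theorems

end
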